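import Summits.AnomalousDissipation.AnomalousDissipation.Theorems.WindLineWindyGalerkinSteadyZerothLawGenericLeafNondegeneracyTools

/-!
# Generic leaf-nondegeneracy (stub B of crux `WindLine.WindyGalerkinSteadyZerothLaw`,
# stmt-AnomalousDissipation-11414), tools B: properness of the drifted steady lattice map

Helper layer (pure proof file, no definitions), sequel of `…GenericLeafNondegeneracyTools.lean`.
On the state space `W ⊂ ℓ²(ℤ³; ℂ³)` of `SteadyLattice` with its bounded bilinear map `B` and a drift
multiplier `D = D_M` (`SteadyLatticeDrift.exists_drift`), the drifted steady map
`G(x) = c x + D x + B(x,x)`, `c > 0`, is **proper on bounded sets**: a `W`-bounded sequence `xₙ`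
whose images `G(xₙ)` converge has a `W`-convergent subsequence, and the limit solves the limit
equation (`exists_tendsto_subseq_of_bounded`).  Proof: lattice Rellich
(`Lattice.rellich`, one weight: `x̌ₙ` is `H¹`-Cauchy along a subsequence), the Agmon interpolation
and the `ℓ¹ × H¹ → ℓ²` bilinear estimate of tools A (so `B(xₙ,xₙ)` and `D xₙ` are Cauchy in `W`),
and `c xₙ = G(xₙ) − D xₙ − B(xₙ,xₙ)`.

References: Foias–Temam, CPAM 30 (1977) §1; Saut–Temam, Indiana Univ. Math. J. 29 (1980) §2
(properness of the steady Navier–Stokes map); Temam 1979 Ch. II §1.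
-/

noncomputable section

-- D-0017: single-problem summit ⇒ the duplicated namespace segment is by design.
set_option linter.dupNamespace false

open scoped BigOperators Topology ENNReal NNReal InnerProductSpace ComplexConjugate
open Filter Set Function TopologicalSpace MeasureTheory UnitAddTorus
open Literature.Analysis.FunctionSpaces Literature.Analysis.FunctionSpaces.Torus
open Literature.Analysis.FunctionSpaces.EuclideanSpace
open Literature.Analysis.FluidPDE Literature.Analysis.FluidPDE.Torus
open Literature.Analysis.FluidPDE.ScalarFourier
open Literature.Analysis.FluidPDE.SteadyLattice Literature.Analysis.FluidPDE.SteadyLatticeDrift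

namespace Summit.AnomalousDissipation.AnomalousDissipation.Theorems.WindLineWindyGalerkinSteadyZerothLaw.GenericLeaf

/-- Complex coefficient vectors (local notation). -/
local notation "ℂ³" => EuclideanSpace ℂ (Fin 3)
/-- Square-summable coefficient families `ℤ³ → ℂ³` (local notation). -/
local notation "ℓ2" => lp (fun _ : Fin 3 → ℤ => EuclideanSpace ℂ (Fin 3)) 2
/-- Physical coefficients `x̌(k) = x(k)/|k|²` of a family (local notation, the tree's `cf`). -/
local notation "cf[" X "]" =>
  ((fun mm : Fin 3 → ℤ => (((freqNormSq mm)⁻¹ : ℝ) : ℂ)) • (X : (Fin 3 → ℤ) → EuclideanSpace ℂ (Fin 3)))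
/-- `k · v = ∑ⱼ kⱼ vⱼ` (local notation, the tree's `kdot`). -/
local notation "kdot[" k "," v "]" =>
  (∑ jj : Fin 3, (((k : Fin 3 → ℤ) jj : ℤ) : ℂ) * (v : EuclideanSpace ℂ (Fin 3)) jj)
/-- The convective symbol `N(a, b)(k)` as a vector of `ℂ³` (local notation, the tree's `nl`). -/
local notation "nl[" a "," b "," k "]" =>
  ((WithLp.toLp 2 (fun pp : Fin 3 => transportSym (fun jj mm => (a : (Fin 3 → ℤ) → EuclideanSpace ℂ (Fin 3)) mm jj)
    (fun mm => (b : (Fin 3 → ℤ) → EuclideanSpace ℂ (Fin 3)) mm pp) k)) : EuclideanSpace ℂ (Fin 3))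

/-! ## §1 Small lemmas -/

/-- `cf` is additive: `(x − y)̌ = x̌ − y̌`. [folklore] -/
theorem cf_sub (x y : (Fin 3 → ℤ) → ℂ³) : cf[x - y] = cf[x] - cf[y] := by
  funext k
  simp only [Pi.smul_apply', Pi.sub_apply, smul_sub]

/-- `x = (x²)^{1/2}` in `ℝ≥0∞`. [folklore] -/
theorem eq_sq_rpow_half (a : ℝ≥0∞) : a = (a ^ 2) ^ (1 / 2 : ℝ) := by
  rw [← ENNReal.rpow_natCast, ← ENNReal.rpow_mul]; norm_num

/-- From `a² ≤ b` to `a ≤ b^{1/2}` in `ℝ≥0∞`. [folklore] -/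
theorem le_rpow_half_of_sq_le {a b : ℝ≥0∞} (h : a ^ 2 ≤ b) : a ≤ b ^ (1 / 2 : ℝ) := by
  rw [eq_sq_rpow_half a]
  exact ENNReal.rpow_le_rpow h (by norm_num)

/-- A two-index family which is eventually small is null along `atTop` on `ℕ × ℕ`. [folklore] -/
theorem tendsto_prod_atTop_zero_of_forall {f : ℕ → ℕ → ℝ≥0∞}
    (h : ∀ ε : ℝ≥0∞, 0 < ε → ∃ N : ℕ, ∀ i j, N ≤ i → N ≤ j → f i j ≤ ε) :
    Tendsto (fun p : ℕ × ℕ => f p.1 p.2) atTop (𝓝 0) := by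
  rw [ENNReal.tendsto_atTop_zero]
  intro ε hε
  obtain ⟨N, hN⟩ := h ε hε
  exact ⟨(N, N), fun p hp => hN p.1 p.2 hp.1 hp.2⟩

/-- A sequence converging in a seminormed group has `‖u i − u j‖ₑ → 0` on `ℕ × ℕ`. [folklore] -/
theorem tendsto_enorm_sub_prod_of_tendsto {E : Type*} [SeminormedAddCommGroup E] {u : ℕ → E} {a : E}
    (h : Tendsto u atTop (𝓝 a)) : Tendsto (fun p : ℕ × ℕ => ‖u p.1 - u p.2‖ₑ) atTop (𝓝 0) := by
  have h0 : Tendsto (fun n => ‖u n - a‖ₑ) atTop (𝓝 0) := by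
    have := (tendsto_iff_edist_tendsto_0.1 h)
    simpa only [edist_eq_enorm_sub] using this
  have h1 : Tendsto (fun p : ℕ × ℕ => ‖u p.1 - a‖ₑ) atTop (𝓝 0) := by
    rw [← prod_atTop_atTop_eq]; exact h0.comp tendsto_fst
  have h2 : Tendsto (fun p : ℕ × ℕ => ‖u p.2 - a‖ₑ) atTop (𝓝 0) := by
    rw [← prod_atTop_atTop_eq]; exact h0.comp tendsto_snd
  have hsum : Tendsto (fun p : ℕ × ℕ => ‖u p.1 - a‖ₑ + ‖u p.2 - a‖ₑ) atTop (𝓝 0) := by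
    simpa using h1.add h2
  refine tendsto_of_tendsto_of_tendsto_of_le_of_le tendsto_const_nhds hsum (fun _ => bot_le) fun p => ?_
  calc ‖u p.1 - u p.2‖ₑ = ‖(u p.1 - a) - (u p.2 - a)‖ₑ := by congr 1; abel
    _ ≤ ‖u p.1 - a‖ₑ + ‖u p.2 - a‖ₑ := enorm_sub_le

/-- A sequence with `‖u i − u j‖ₑ → 0` on `ℕ × ℕ` is Cauchy. [folklore] -/
theorem cauchySeq_of_tendsto_enorm_sub_prod {E : Type*} [SeminormedAddCommGroup E] {u : ℕ → E}
    (h : Tendsto (fun p : ℕ × ℕ => ‖u p.1 - u p.2‖ₑ) atTop (𝓝 0)) : CauchySeq u := by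
  rw [EMetric.cauchySeq_iff]
  intro ε hε
  by_cases htop : ε = ∞
  · exact ⟨0, fun m _ n _ => by rw [htop]; exact edist_lt_top _ _⟩
  have hε2 : 0 < ε / 2 := ENNReal.half_pos hε.ne'
  obtain ⟨N, hN⟩ := ENNReal.tendsto_atTop_zero.1 h (ε / 2) hε2
  refine ⟨N.1 ⊔ N.2, fun m hm n hn => ?_⟩
  have hle := hN (m, n) ⟨le_of_max_le_left hm, le_of_max_le_right hn⟩
  rw [edist_eq_enorm_sub]
  exact lt_of_le_of_lt hle (ENNReal.half_lt_self hε.ne' htop)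

/-! ## §2 Properness of the drifted steady map on bounded sets -/

section Proper

variable {W : Submodule ℝ ℓ2}

/-- The extended norm of `z ∈ W` is that of its `ℓ²` representative. [folklore] -/
theorem enorm_coeW (z : W) : ‖(z : ℓ2)‖ₑ = ‖z‖ₑ := rfl
variable (B : W → W → W)
variable (hB : ∀ x y : W, (((B x y : W) : ℓ2) : (Fin 3 → ℤ) → ℂ³) = fun k =>
  lerayCoeff k nl[cf[((x : ℓ2) : (Fin 3 → ℤ) → ℂ³)], cf[((y : ℓ2) : (Fin 3 → ℤ) → ℂ³)], k])
variable (hBb : IsBoundedBilinearMap ℝ (fun p : W × W => B p.1 p.2))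
variable {M : ℂ³} (D : W →L[ℝ] W)
variable (hD : ∀ x : W, (((D x : W) : ℓ2) : (Fin 3 → ℤ) → ℂ³) = fun k =>
  (2 * Real.pi * Complex.I * kdot[k, M]) • cf[((x : ℓ2) : (Fin 3 → ℤ) → ℂ³)] k)

/-- The drifted steady map `x ↦ c x + D x + B(x,x)` is continuous on `W`. [folklore] -/
theorem continuous_steadyMap (hBb : IsBoundedBilinearMap ℝ (fun p : W × W => B p.1 p.2)) (D : W →L[ℝ] W)
    (c : ℝ) : Continuous fun x : W => c • x + D x + B x x :=
  ((continuous_const_smul c).add D.continuous).add (hBb.continuous.comp (continuous_id.prodMk continuous_id))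

include hB hBb hD in
/-- **The key Cauchy estimate.** For `x, y ∈ W` with `‖x‖, ‖y‖ ≤ R` (so `‖x̌‖_{H¹}, ‖y̌‖_{H¹} ≤ 2R`):
`‖x − y‖ ≤ c⁻¹ (‖G x − G y‖ + 6π‖M‖ e^{1/2} + 18π ((2R C_A)^{1/2} (e^{1/2})^{1/2} · 2R + (2R² C_A)^{1/2} e^{1/2}))`
with `e = ‖(x − y)̌‖²_{H¹}`, `G z = c z + D z + B(z,z)` and `C_A` the Agmon constant. [folklore] -/
theorem enorm_sub_le_of_steadyMap {C : ℝ≥0∞}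
    (hA : ∀ z : ℓ2, (∑' m, ‖cf[((z : ℓ2) : (Fin 3 → ℤ) → ℂ³)] m‖ₑ) ^ 2 ≤
      C * (Lattice.eNormSq 1 cf[((z : ℓ2) : (Fin 3 → ℤ) → ℂ³)]) ^ (1 / 2 : ℝ) * ‖z‖ₑ)
    {c : ℝ} (hc : 0 < c) {R : ℝ≥0∞} (x y : W) (hx : ‖x‖ₑ ≤ R) (hy : ‖y‖ₑ ≤ R) :
    ‖x - y‖ₑ ≤ ENNReal.ofReal c⁻¹ * (‖(c • x + D x + B x x) - (c • y + D y + B y y)‖ₑ +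
      ENNReal.ofReal (6 * Real.pi * ‖M‖) * (Lattice.eNormSq 1 cf[(((x - y : W) : ℓ2) : (Fin 3 → ℤ) → ℂ³)]) ^ (1 / 2 : ℝ) +
      ENNReal.ofReal (18 * Real.pi) *
        ((2 * R * C) ^ (1 / 2 : ℝ) * ((Lattice.eNormSq 1 cf[(((x - y : W) : ℓ2) : (Fin 3 → ℤ) → ℂ³)]) ^ (1 / 2 : ℝ)) ^ (1 / 2 : ℝ) *
            (2 * R) +
          (2 * R ^ 2 * C) ^ (1 / 2 : ℝ) * (Lattice.eNormSq 1 cf[(((x - y : W) : ℓ2) : (Fin 3 → ℤ) → ℂ³)]) ^ (1 / 2 : ℝ))) := by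
  -- abbreviations
  set e : ℝ≥0∞ := Lattice.eNormSq 1 cf[(((x - y : W) : ℓ2) : (Fin 3 → ℤ) → ℂ³)] with he
  -- `H¹` bounds from `W` bounds
  have hH : ∀ z : W, ‖z‖ₑ ≤ R → (Lattice.eNormSq 1 cf[((z : ℓ2) : (Fin 3 → ℤ) → ℂ³)]) ^ (1 / 2 : ℝ) ≤ 2 * R := by
    intro z hz
    have h1 : Lattice.eNormSq 1 cf[((z : ℓ2) : (Fin 3 → ℤ) → ℂ³)] ≤ (2 * R) ^ 2 := by
      refine (eNormSq_one_cf_le (z : ℓ2)).trans ?_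
      rw [mul_pow, show ((2 : ℝ≥0∞)) ^ 2 = 4 by norm_num, enorm_coeW]
      exact mul_le_mul_right (pow_le_pow_left' hz 2) _
    calc (Lattice.eNormSq 1 cf[((z : ℓ2) : (Fin 3 → ℤ) → ℂ³)]) ^ (1 / 2 : ℝ) ≤ ((2 * R) ^ 2) ^ (1 / 2 : ℝ) :=
          ENNReal.rpow_le_rpow h1 (by norm_num)
      _ = 2 * R := (eq_sq_rpow_half _).symm
  -- `ℓ¹` bounds from Agmon
  have hxy : ‖x - y‖ₑ ≤ 2 * R := by
    calc ‖x - y‖ₑ ≤ ‖x‖ₑ + ‖y‖ₑ := enorm_sub_le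
      _ ≤ R + R := add_le_add hx hy
      _ = 2 * R := (two_mul R).symm
  have hL1 : (∑' m, ‖cf[(((x - y : W) : ℓ2) : (Fin 3 → ℤ) → ℂ³)] m‖ₑ) ≤
      (2 * R * C) ^ (1 / 2 : ℝ) * (e ^ (1 / 2 : ℝ)) ^ (1 / 2 : ℝ) := by
    rw [← ENNReal.mul_rpow_of_nonneg _ _ (by norm_num : (0 : ℝ) ≤ 1 / 2)]
    refine le_rpow_half_of_sq_le ((hA _).trans ?_)
    rw [← he]
    calc C * e ^ (1 / 2 : ℝ) * ‖((x - y : W) : ℓ2)‖ₑ ≤ C * e ^ (1 / 2 : ℝ) * (2 * R) := by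
          rw [enorm_coeW]; exact mul_le_mul_right hxy _
      _ = 2 * R * C * e ^ (1 / 2 : ℝ) := by ring
  have hL2 : (∑' m, ‖cf[((y : ℓ2) : (Fin 3 → ℤ) → ℂ³)] m‖ₑ) ≤ (2 * R ^ 2 * C) ^ (1 / 2 : ℝ) := by
    refine le_rpow_half_of_sq_le ((hA _).trans ?_)
    calc C * (Lattice.eNormSq 1 cf[((y : ℓ2) : (Fin 3 → ℤ) → ℂ³)]) ^ (1 / 2 : ℝ) * ‖(y : ℓ2)‖ₑ
        ≤ C * (2 * R) * R := by
          rw [enorm_coeW]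
          exact mul_le_mul' (mul_le_mul_right (hH y hy) _) hy
      _ = 2 * R ^ 2 * C := by ring
  -- the identity `c (x − y) = (G x − G y) − D (x − y) − (B x x − B y y)`
  have hid : x - y = c⁻¹ • (((c • x + D x + B x x) - (c • y + D y + B y y)) - D (x - y) - (B x x - B y y)) := by
    rw [map_sub, smul_sub]
    have : ((c • x + D x + B x x) - (c • y + D y + B y y)) - (D x - D y) - (B x x - B y y) = c • (x - y) := by
      rw [smul_sub]; abel
    rw [← smul_sub, this, smul_smul, inv_mul_cancel₀ hc.ne', one_smul]
  -- norms
  have hn : ‖x - y‖ₑ ≤ ENNReal.ofReal c⁻¹ * (‖(c • x + D x + B x x) - (c • y + D y + B y y)‖ₑ +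
      ‖D (x - y)‖ₑ + ‖B x x - B y y‖ₑ) := by
    conv_lhs => rw [hid]
    rw [enorm_smul, ← ofReal_norm, Real.norm_of_nonneg (inv_nonneg.2 hc.le)]
    refine mul_le_mul_right ?_ _
    exact (enorm_sub_le).trans (add_le_add enorm_sub_le le_rfl)
  refine hn.trans (mul_le_mul_right (add_le_add (add_le_add le_rfl (enorm_D_le D hD (x - y))) ?_) _)
  refine (enorm_B_self_sub_le B hB hBb x y).trans (mul_le_mul_right (add_le_add ?_ ?_) _)
  · exact mul_le_mul' hL1 (hH x hx)
  · exact mul_le_mul_left hL2 _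

include hB hBb hD in
/-- **Properness of the drifted steady map on bounded sets** (Foias–Temam 1977 §1; Saut–Temam 1980
§2, on the Fourier lattice).  Let `xₙ ∈ W` be bounded, `‖xₙ‖ ≤ R`, and let
`G(xₙ) = c xₙ + D xₙ + B(xₙ,xₙ) → y` in `W` (`c > 0`, `W` closed).  Then a subsequence `x_{φ n}`
converges in `W` to some `z` with `G(z) = y`.  Proof: Rellich on `x̌ₙ` (`Lattice.rellich`,
`‖x̌ₙ‖_{H²} ≤ 2R`) makes `x̌_{φ n}` Cauchy in `H¹`; the Cauchy estimate `enorm_sub_le_of_steadyMap`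
(Agmon + the bilinear and drift estimates) then makes `x_{φ n}` Cauchy in `W`; `W` is complete and
`G` is continuous. [folklore] -/
theorem exists_tendsto_subseq_of_bounded (hWc : IsClosed (W : Set ℓ2)) {c : ℝ} (hc : 0 < c) {R : ℝ}
    (x : ℕ → W) (hxR : ∀ n, ‖x n‖ ≤ R) {y : W}
    (hy : Tendsto (fun n => c • x n + D (x n) + B (x n) (x n)) atTop (𝓝 y)) :
    ∃ (φ : ℕ → ℕ) (z : W), StrictMono φ ∧ Tendsto (x ∘ φ) atTop (𝓝 z) ∧ c • z + D z + B z z = y := by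
  haveI : CompleteSpace W := completeSpace_W hWc
  obtain ⟨C, hCtop, hA⟩ := exists_agmon_const
  set R' : ℝ≥0∞ := ENNReal.ofReal R with hR'
  have hxe : ∀ n, ‖x n‖ₑ ≤ R' := fun n => by
    rw [hR', ← ofReal_norm]; exact ENNReal.ofReal_le_ofReal (hxR n)
  -- Rellich on `x̌ₙ`
  have hu : ∀ n, Lattice.eNormSq 2 cf[((x n : ℓ2) : (Fin 3 → ℤ) → ℂ³)] ≤ 4 * R' ^ 2 := fun n =>
    (eNormSq_two_cf_le (x n : ℓ2)).trans (mul_le_mul_right (pow_le_pow_left' (by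
      rw [enorm_coeW]; exact hxe n) 2) _)
  have hRtop : 4 * R' ^ 2 ≠ ∞ := ENNReal.mul_ne_top (by simp) (ENNReal.pow_ne_top ENNReal.ofReal_ne_top)
  obtain ⟨φ, hφ, hCauchy⟩ := Lattice.rellich (V := ℂ³) (s := (1 : ℝ)) (t := 2) (by norm_num)
    (u := fun n => cf[((x n : ℓ2) : (Fin 3 → ℤ) → ℂ³)]) hRtop hu
  -- `e p = ‖(x_{φ p₁} − x_{φ p₂})̌‖²_{H¹} → 0`
  set e : ℕ × ℕ → ℝ≥0∞ := fun p =>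
    Lattice.eNormSq 1 cf[(((x (φ p.1) - x (φ p.2) : W) : ℓ2) : (Fin 3 → ℤ) → ℂ³)] with hedef
  have he : Tendsto e atTop (𝓝 0) := by
    refine tendsto_prod_atTop_zero_of_forall (f := fun i j =>
      Lattice.eNormSq 1 cf[(((x (φ i) - x (φ j) : W) : ℓ2) : (Fin 3 → ℤ) → ℂ³)]) fun ε hε => ?_
    obtain ⟨N, hN⟩ := hCauchy ε hε
    refine ⟨N, fun i j hi hj => ?_⟩
    have h := hN i j hi hj
    rwa [coeW_sub, cf_sub]
  -- `g p = ‖G(x_{φ p₁}) − G(x_{φ p₂})‖ → 0`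
  set g : ℕ × ℕ → ℝ≥0∞ := fun p => ‖(c • x (φ p.1) + D (x (φ p.1)) + B (x (φ p.1)) (x (φ p.1))) -
      (c • x (φ p.2) + D (x (φ p.2)) + B (x (φ p.2)) (x (φ p.2)))‖ₑ with hgdef
  have hg : Tendsto g atTop (𝓝 0) :=
    tendsto_enorm_sub_prod_of_tendsto (u := fun n => c • x (φ n) + D (x (φ n)) + B (x (φ n)) (x (φ n)))
      (hy.comp hφ.tendsto_atTop)
  -- the majorant `Ψ(e, g) → 0`
  have hfin1 : (2 * R' * C) ^ (1 / 2 : ℝ) ≠ ∞ := ENNReal.rpow_ne_top_of_nonneg (by norm_num)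
    (ENNReal.mul_ne_top (ENNReal.mul_ne_top (by simp) ENNReal.ofReal_ne_top) hCtop)
  have hfin2 : (2 * R' ^ 2 * C) ^ (1 / 2 : ℝ) ≠ ∞ := ENNReal.rpow_ne_top_of_nonneg (by norm_num)
    (ENNReal.mul_ne_top (ENNReal.mul_ne_top (by simp) (ENNReal.pow_ne_top ENNReal.ofReal_ne_top)) hCtop)
  have he2 : Tendsto (fun p => e p ^ (1 / 2 : ℝ)) atTop (𝓝 0) := by
    have h := ((ENNReal.continuous_rpow_const (y := (1 / 2 : ℝ))).tendsto 0).comp he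
    rwa [ENNReal.zero_rpow_of_pos (by norm_num : (0 : ℝ) < 1 / 2)] at h
  have he4 : Tendsto (fun p => (e p ^ (1 / 2 : ℝ)) ^ (1 / 2 : ℝ)) atTop (𝓝 0) := by
    have h := ((ENNReal.continuous_rpow_const (y := (1 / 2 : ℝ))).tendsto 0).comp he2
    rwa [ENNReal.zero_rpow_of_pos (by norm_num : (0 : ℝ) < 1 / 2)] at h
  have hΨ : Tendsto (fun p => ENNReal.ofReal c⁻¹ * (g p +
      ENNReal.ofReal (6 * Real.pi * ‖M‖) * e p ^ (1 / 2 : ℝ) +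
      ENNReal.ofReal (18 * Real.pi) *
        ((2 * R' * C) ^ (1 / 2 : ℝ) * (e p ^ (1 / 2 : ℝ)) ^ (1 / 2 : ℝ) * (2 * R') +
          (2 * R' ^ 2 * C) ^ (1 / 2 : ℝ) * e p ^ (1 / 2 : ℝ)))) atTop (𝓝 0) := by
    have t1 : Tendsto (fun p => ENNReal.ofReal (6 * Real.pi * ‖M‖) * e p ^ (1 / 2 : ℝ)) atTop (𝓝 0) := by
      have h := ENNReal.Tendsto.const_mul (a := ENNReal.ofReal (6 * Real.pi * ‖M‖)) he2
        (Or.inr ENNReal.ofReal_ne_top)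
      rwa [mul_zero] at h
    have t2 : Tendsto (fun p => (2 * R' * C) ^ (1 / 2 : ℝ) * (e p ^ (1 / 2 : ℝ)) ^ (1 / 2 : ℝ) * (2 * R')) atTop
        (𝓝 0) := by
      have h := ENNReal.Tendsto.const_mul (a := (2 * R' * C) ^ (1 / 2 : ℝ)) he4 (Or.inr hfin1)
      rw [mul_zero] at h
      have h' := ENNReal.Tendsto.mul_const (b := 2 * R') h
        (Or.inr (ENNReal.mul_ne_top (by simp) ENNReal.ofReal_ne_top))
      rwa [zero_mul] at h'
    have t3 : Tendsto (fun p => (2 * R' ^ 2 * C) ^ (1 / 2 : ℝ) * e p ^ (1 / 2 : ℝ)) atTop (𝓝 0) := by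
      have h := ENNReal.Tendsto.const_mul (a := (2 * R' ^ 2 * C) ^ (1 / 2 : ℝ)) he2 (Or.inr hfin2)
      rwa [mul_zero] at h
    have t4 : Tendsto (fun p => ENNReal.ofReal (18 * Real.pi) *
        ((2 * R' * C) ^ (1 / 2 : ℝ) * (e p ^ (1 / 2 : ℝ)) ^ (1 / 2 : ℝ) * (2 * R') +
          (2 * R' ^ 2 * C) ^ (1 / 2 : ℝ) * e p ^ (1 / 2 : ℝ))) atTop (𝓝 0) := by
      have h := ENNReal.Tendsto.const_mul (a := ENNReal.ofReal (18 * Real.pi)) (t2.add t3)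
        (Or.inr ENNReal.ofReal_ne_top)
      rwa [add_zero, mul_zero] at h
    have h := ENNReal.Tendsto.const_mul (a := ENNReal.ofReal c⁻¹) ((hg.add t1).add t4)
      (Or.inr ENNReal.ofReal_ne_top)
    rwa [add_zero, add_zero, mul_zero] at h
  -- squeeze: `x ∘ φ` is Cauchy
  have hd : Tendsto (fun p : ℕ × ℕ => ‖x (φ p.1) - x (φ p.2)‖ₑ) atTop (𝓝 0) :=
    tendsto_of_tendsto_of_tendsto_of_le_of_le tendsto_const_nhds hΨ (fun _ => bot_le) fun p =>
      enorm_sub_le_of_steadyMap B hB hBb D hD hA hc (x (φ p.1)) (x (φ p.2)) (hxe _) (hxe _)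
  have hcs : CauchySeq (x ∘ φ) := cauchySeq_of_tendsto_enorm_sub_prod hd
  obtain ⟨z, hz⟩ := cauchySeq_tendsto_of_complete hcs
  refine ⟨φ, z, hφ, hz, ?_⟩
  have h1 : Tendsto (fun n => c • (x ∘ φ) n + D ((x ∘ φ) n) + B ((x ∘ φ) n) ((x ∘ φ) n)) atTop
      (𝓝 (c • z + D z + B z z)) :=
    ((continuous_steadyMap B hBb D c).tendsto z).comp hz
  have h2 : Tendsto (fun n => c • (x ∘ φ) n + D ((x ∘ φ) n) + B ((x ∘ φ) n) ((x ∘ φ) n)) atTop (𝓝 y) :=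
    hy.comp hφ.tendsto_atTop
  exact tendsto_nhds_unique h1 h2

end Proper

/-! ## §3 Registered sub-goal -/

/-- **Registered sub-goal `genericLeaf_toolsB`** (worker B of stub `stub_genericLeafNondegeneracy`):
properness of the drifted steady lattice map on bounded sets, `exists_tendsto_subseq_of_bounded` in
Pi-form. [folklore] -/
theorem genericLeaf_toolsB : ∀ (W : Submodule ℝ ℓ2), IsClosed (W : Set ℓ2) → ∀ (B : W → W → W), (∀ x y : W, (((B x y : W) : ℓ2) : (Fin 3 → ℤ) → ℂ³) = fun k => lerayCoeff k nl[cf[((x : ℓ2) : (Fin 3 → ℤ) → ℂ³)], cf[((y : ℓ2) : (Fin 3 → ℤ) → ℂ³)], k]) → IsBoundedBilinearMap ℝ (fun p : W × W => B p.1 p.2) → ∀ (M : ℂ³) (D : W →L[ℝ] W), (∀ x : W, (((D x : W) : ℓ2) : (Fin 3 → ℤ) → ℂ³) = fun k => (2 * Real.pi * Complex.I * kdot[k, M]) • cf[((x : ℓ2) : (Fin 3 → ℤ) → ℂ³)] k) → ∀ (c : ℝ), 0 < c → ∀ (R : ℝ) (x : ℕ → W), (∀ n, ‖x n‖ ≤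 R) → ∀ y : W, Tendsto (fun n => c • x n + D (x n) + B (x n) (x n)) atTop (𝓝 y) → ∃ (φ : ℕ → ℕ) (z : W), StrictMono φ ∧ Tendsto (x ∘ φ) atTop (𝓝 z) ∧ c • z + D z + B z z = y :=
  fun _ hWc B hB hBb _ D hD _ hc _ x hxR _ hy => exists_tendsto_subseq_of_bounded B hB hBb D hD hWc hc x hxR hy

end Summit.AnomalousDissipation.AnomalousDissipation.Theorems.WindLineWindyGalerkinSteadyZerothLaw.GenericLeaf

end
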